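import Literature.AlgebraicGeometry.Frobenioids.DivSlimRemarkInstances
import Literature.AlgebraicGeometry.Frobenioids.ElementaryIsFrobenioid
import Literature.AlgebraicGeometry.Frobenioids.ElementaryFrobeniusCompact
import Literature.AlgebraicGeometry.Frobenioids.FrobenioidMonoidIsoTransport
import Literature.AlgebraicGeometry.Frobenioids.FrobenioidNatIsoTransport
import Literature.AlgebraicGeometry.Frobenioids.FrobenioidEquivalence
import Literature.AlgebraicGeometry.Frobenioids.PreFrobenioidDataToFunctor
import Literature.AlgebraicGeometry.Frobenioids.MonoidsCharacteristicTypeAutomatic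
import Literature.AlgebraicGeometry.Frobenioids.DegreeModelFrobenioid
import Literature.AlgebraicGeometry.Frobenioids.Prop55Sub
import Literature.AlgebraicGeometry.Frobenioids.Prop55SubRatStdSlot
import Literature.AlgebraicGeometry.Frobenioids.BiratFrobeniusCompactCriterion
import Literature.AlgebraicGeometry.Frobenioids.UnitTrivialModelType
import Literature.AlgebraicGeometry.Frobenioids.IsoSubanchorNotIsotropic
import Literature.AlgebraicGeometry.Frobenioids.BaseIdentityPreStepsSlim
import HarnessLib

/-!
# Frobenioids I, Remark 4.12.1 — the Frobenioid of Example 3.10 IS a Frobenioid, of standard and of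
# rationally standard type AT THE Def. 4.5 (iii) parameters (proof-only)

Mochizuki, *The geometry of Frobenioids I: the general theory*, Kyushu J. Math. **62** (2008) 293–400,
Example 3.10 p. 72 ("the Frobenioid `C`" over the one-object category `D` of a group `G`, "which may be
identified with the elementary Frobenioid determined by the monoid on `D` that assigns … `ℤ_{≥0}`") and
Remark 4.12.1 p. 95 ("`C` is of rationally standard type") [cite: MochizukiFrdI2008, Rem. 4.12.1 p.95].

WHY THIS FILE (abc-iut cell, D-0079 sub-cell L-F [FrdI/II], GAP-1 of `plan/L1/LF-FRD.tsv` = FACT row F-1023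
`Rmk4121.Statement`, conjunct (1); seat abc-iut-f-009 gen 4, routed by abc-iut-L1-lead).  Seat abc-iut-w5-d042
closed conjuncts (2)–(5) of `Rmk4121.Statement G R` and reduced the row to conjunct (1), "`C` is of rationally
standard type" over the Def. 4.5 (iii) parameter bundle `R : (Ex310.data G).RSParams`
(`Rmk4121.statement_of_isOfRationallyStandardType`).  The faithful value of `R` is THE bundle of
`Prop55Sub.lean` — THE birationalization `C → C^birat` (Prop. 4.4), THE unit-trivialisation `C^un-tr` and ITS
birationalization — which the tree forms for structure FUNCTORS `C → F_Φ` that are Frobenioids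
(`PreFrobenioid.rsParams hF Supp`).  The operations `Ex310.data G` (seat abc-iut-L1-t3) are such a functor
through the round trip `PreFrobenioidData.toFunctor` (`ofFunctor S.monFunctor S.toFunctor = S` holds by
`rfl`), so NO new definition is needed: this PROOF-ONLY file supplies

* `Ex310.isFrobenioid` — "the Frobenioid `C`" of Ex. 3.10 IS a Frobenioid ([FrdI] Def. 1.3): the structure
  functor `(Ex310.data G).toFunctor : C → F_Φ`, `Φ ≡ ℤ_{≥0}`, is an isomorphism of categories onto the
  elementary Frobenioid `F_Φ`, and `F_Φ → F_{Φ^char} ≅ F_Φ` is a Frobenioid by Prop. 1.5 (i)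
  (`ElemFrobenioid.isFrobenioid_toChar`; `ℤ_{≥0}` is sharp so `Φ^char ≅ Φ`), transported along
  `IsFrobenioid.comp_map_of_iso` / `of_natIso` / `comp_of_isEquivalence`;
* `Ex310.isOfStandardType` — `C` is of standard type (Def. 3.1 (i));
* `Ex310.isOfRationallyStandardType_rsParams` — `C` is of rationally standard type (Def. 4.5 (iii)) AT THE
  parameters `PreFrobenioid.rsParams Ex310.isFrobenioid PrimarySupp`: birationally Frobenius-normalized by
  Thm. 5.1 (iv) (isotropic + unit-trivial), rational (`1 ∈ Φ^birat(⋆) = Φ^gp`), standard, and the unique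
  object of `(C^un-tr)^birat` is Frobenius-compact (abc-iut-L6-t10's criterion at `d₀ = 1`);
* `Rmk4121.statement_rsParams` — **Remark 4.12.1 AT THE PARAMETERS** for every non-trivial group `G`.

0 `def`s; honest framing: classical, refereed [FrdI]; nothing here bears on [IUTchIII] Cor. 3.12; a FACT row
is an assumption label on OUR typing; PROVED = OUR kernel check.
-/

namespace Literature.AlgebraicGeometry.Frobenioids

open CategoryTheory Opposite

namespace Ex310

variable (G : Type) [Group G]

/-! ### The divisor monoid `Φ ≡ ℤ_{≥0}` of Example 3.10 and its base `D = B(G)` -/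

/-- The pull-back maps of `Φ ≡ ℤ_{≥0}` are identities. [cite: MochizukiFrdI2008, Ex. 3.10 p.72] -/
theorem pull_monFunctor {X Y : D G} (f : Y ⟶ X) (x : (data G).monFunctor.obj (op X)) :
    pull (data G).monFunctor f x = x := rfl

/-- `Φ ≡ ℤ_{≥0}` is a monoid on `D` ([FrdI] Def. 1.1 (ii): all pull-back maps are bijective).
[cite: MochizukiFrdI2008, Ex. 3.10 p.72] -/
theorem isMonoidOn_monFunctor : IsMonoidOn (data G).monFunctor :=
  isMonoidOn_of_bijective fun _ => ⟨fun _ _ h => h, fun y => ⟨y, rfl⟩⟩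

/-- `Φ ≡ ℤ_{≥0}` is objectwise divisorial. [cite: MochizukiFrdI2008, Ex. 3.10 p.72] -/
theorem isDivisorial_monFunctor : Objectwise (fun M _ => IsDivisorial M) (data G).monFunctor :=
  fun _ => DegreeModel.isDivisorial_N

/-- `D = B(G)` is totally epimorphic (a groupoid). [cite: MochizukiFrdI2008, Ex. 3.10 p.72] -/
theorem isTotallyEpimorphic_D : IsTotallyEpimorphic (D G) := ⟨fun _ => inferInstance⟩

/-! ### `Φ^char ≅ Φ`: `ℤ_{≥0}` is sharp -/

/-- `Associates.mk : ℤ_{≥0} → ℤ_{≥0}^char` is bijective (`ℤ_{≥0}` is sharp). [cite: MochizukiFrdI2008, Def. 1.1 (i) p.19] -/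
theorem associatesMk_bijective_nat :
    Function.Bijective (Associates.mkMonoidHom : Multiplicative ℕ →* Associates (Multiplicative ℕ)) :=
  ⟨associatesMk_injective_of_isSharp isSharp_multiplicative_nat, Associates.mk_surjective⟩

/-- There is an isomorphism `Φ^char ≅ Φ` of monoids on `D` under which `Associates.mk` becomes the identity.
[cite: MochizukiFrdI2008, Def. 1.1 (ii) p.19] -/
theorem exists_charFunctor_iso :
    ∃ θ : charFunctor (data G).monFunctor ≅ (data G).monFunctor,
      ∀ (X : (D G)ᵒᵖ) (a : (data G).monFunctor.obj X), (θ.hom.app X).hom (Associates.mk a) = a := by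
  let e : Multiplicative ℕ ≃* Associates (Multiplicative ℕ) :=
    MulEquiv.ofBijective Associates.mkMonoidHom associatesMk_bijective_nat
  have he : ∀ a : Multiplicative ℕ, e.symm (Associates.mk a) = a := fun a => e.symm_apply_apply a
  refine ⟨NatIso.ofComponents (fun X => e.symm.toCommMonCatIso) ?_, fun X a => he a⟩
  intro X Y f
  ext x
  obtain ⟨a, rfl⟩ := Associates.mk_surjective x
  change e.symm (associatesMap (MonoidHom.id _) (Associates.mk a)) = e.symm (Associates.mk a)
  rw [associatesMap_mk]
  rfl

/-! ### The structure functor `C → F_Φ` is an isomorphism of categories -/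

/-- `C → F_Φ` is faithful. [cite: MochizukiFrdI2008, Ex. 3.10 p.72] -/
theorem toFunctor_faithful : (data G).toFunctor.Faithful := by
  refine ⟨fun {X Y} f g h => ?_⟩
  have h1 : (data G).base.map f = (data G).base.map g := congrArg ElemFrobenioid.Hom.base h
  have h2 : (data G).div f = (data G).div g := congrArg ElemFrobenioid.Hom.div h
  have h3 : (data G).degFr f = (data G).degFr g := congrArg ElemFrobenioid.Hom.degFr h
  exact Prod.ext h1 (ElemFrobenioidMonoid.ext h2 h3)

/-- `C → F_Φ` is full. [cite: MochizukiFrdI2008, Ex. 3.10 p.72] -/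
theorem toFunctor_full : (data G).toFunctor.Full :=
  ⟨fun {X Y} φ => ⟨(show X ⟶ Y from ((show G from φ.base), ⟨φ.div, φ.degFr⟩)), rfl⟩⟩

/-- `C → F_Φ` is essentially surjective (both categories have the one object). [cite: MochizukiFrdI2008, Ex. 3.10 p.72] -/
theorem toFunctor_essSurj : (data G).toFunctor.EssSurj :=
  ⟨fun _ => ⟨SingleObj.star _, ⟨Iso.refl _⟩⟩⟩

/-- `C → F_Φ` is an equivalence (indeed an isomorphism) of categories: "`C` may be identified with the
elementary Frobenioid determined by the monoid … `ℤ_{≥0}`" (FrdI p. 72). [cite: MochizukiFrdI2008, Ex. 3.10 p.72] -/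
theorem toFunctor_isEquivalence : (data G).toFunctor.IsEquivalence :=
  haveI := toFunctor_faithful G
  haveI := toFunctor_full G
  haveI := toFunctor_essSurj G
  { }

/-! ### Example 3.10: `C` is a Frobenioid -/

/-- **Example 3.10: "the Frobenioid `C`"** — the category `C = B(G × 𝔽)` with its pre-Frobenioid structure
`(Ex310.data G).toFunctor : C → F_Φ` over `D = B(G)`, `Φ ≡ ℤ_{≥0}`, IS a Frobenioid ([FrdI] Def. 1.3), for
EVERY group `G`: by Prop. 1.5 (i) `F_Φ → F_{Φ^char}` is a Frobenioid (`Φ` divisorial on the connected,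
totally epimorphic `D`), `Φ^char ≅ Φ` (`ℤ_{≥0}` is sharp), and `C → F_Φ` is an isomorphism of categories.
[cite: MochizukiFrdI2008, Ex. 3.10 p.72] -/
theorem isFrobenioid : PreFrobenioid.IsFrobenioid (data G).toFunctor := by
  obtain ⟨θ, hθ⟩ := exists_charFunctor_iso G
  -- Prop. 1.5 (i) for `Φ ≡ ℤ_{≥0}` on `B(G)`
  have h1 : PreFrobenioid.IsFrobenioid (ElemFrobenioid.toChar (data G).monFunctor) :=
    ElemFrobenioid.isFrobenioid_toChar (isMonoidOn_monFunctor G)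
      (fun X => (isDivisorial_monFunctor G X).isPreDivisorial) (isGraphConnected_singleObj G)
      (isTotallyEpimorphic_D G)
  -- transport along `Φ^char ≅ Φ`
  have h2 : PreFrobenioid.IsFrobenioid
      (ElemFrobenioid.toChar (data G).monFunctor ⋙ ElemFrobenioid.map θ.hom) := h1.comp_map_of_iso θ
  -- the composite `F_Φ → F_{Φ^char} → F_Φ` is (isomorphic to) the identity
  have e : ElemFrobenioid.toChar (data G).monFunctor ⋙ ElemFrobenioid.map θ.hom ≅
      𝟭 (ElemFrobenioid (data G).monFunctor) :=
    NatIso.ofComponents (fun A => Iso.refl A) fun {A B} φ => by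
      refine ElemFrobenioid.Hom.ext ?_ ?_ ?_
      · simp only [Functor.comp_map, Functor.id_map, Iso.refl_hom, ElemFrobenioid.base_comp,
          ElemFrobenioid.base_id, ElemFrobenioid.base_map_map, ElemFrobenioid.base_toChar_map]
        erw [Category.comp_id, Category.id_comp]
      · simp only [Functor.comp_map, Functor.id_map, Iso.refl_hom, ElemFrobenioid.div_comp,
          ElemFrobenioid.div_id, ElemFrobenioid.div_map_map, ElemFrobenioid.div_toChar_map,
          ElemFrobenioid.degFr_id, PNat.one_coe, pow_one, pull_monFunctor]
        erw [hθ, one_mul, one_pow, mul_one]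
      · simp
  have h3 : PreFrobenioid.IsFrobenioid (𝟭 (ElemFrobenioid (data G).monFunctor)) :=
    PreFrobenioid.IsFrobenioid.of_natIso e h2
  -- precompose with the isomorphism of categories `C → F_Φ`
  haveI := toFunctor_isEquivalence G
  have h4 := PreFrobenioid.IsFrobenioid.comp_of_isEquivalence (F := 𝟭 _) (data G).toFunctor h3
  simpa only [Functor.comp_id] using h4

/-! ### Example 3.10: `C` is of standard type -/

/-- `Φ ≡ ℤ_{≥0}` is non-dilating on `D` (its transition maps are identities).
[cite: MochizukiFrdI2008, Def. 1.1 (ii) p.19] -/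
theorem isNonDilatingOn : (data G).IsNonDilatingOn :=
  ⟨fun _ _ _ a => by
    obtain ⟨a, rfl⟩ := Associates.mk_surjective a
    rw [associatesMap_mk]
    rfl⟩

/-- `C` is of Frobenius-isotropic type (every object is isotropic; take the identity as the arrow of
Frobenius type). [cite: MochizukiFrdI2008, Def. 1.2 (v) p.23] -/
theorem isOfFrobeniusIsotropicType : (data G).IsOfFrobeniusIsotropicType :=
  ⟨fun A => ⟨A, 𝟙 A, ⟨⟨isCoAngular _, (data G).div_id A⟩, IsIso.of_groupoid _⟩, isOfIsotropicType.obj A⟩⟩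

/-- **Example 3.10 / Remark 4.12.1: `C` is of standard type** ([FrdI] Def. 3.1 (i)): quasi-isotropic (a
Frobenioid of isotropic type, Rem. 3.1.1), Frobenius-isotropic, not group-like (so (b) is vacuous),
Frobenius-normalized (Ex. 3.10), `D = B(G)` of FSM- hence FSMFF-type, `Φ` non-dilating.
[cite: MochizukiFrdI2008, Rem. 4.12.1 p.95] -/
theorem isOfStandardType : (data G).IsOfStandardType where
  quasiIsotropic :=
    isOfQuasiIsotropicType_of_isOfIsotropicType (data G).monFunctor (data G).toFunctor (isFrobenioid G)
      isOfIsotropicType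
  frobeniusIsotropic := isOfFrobeniusIsotropicType G
  frobeniusCompact_of_groupLike := fun h => absurd h not_isOfGroupLikeType
  frobeniusNormalized := isOfFrobeniusNormalizedType
  fsmff := isOfFSMType.isOfFSMFFType
  nonDilating := isNonDilatingOn G

/-! ### Example 3.10 at THE Def. 4.5 (iii) parameters: `C` is of rationally standard type -/

/-- `C` is of isotropic type, functor form. [cite: MochizukiFrdI2008, Ex. 3.10 p.72] -/
theorem isOfIsotropicType_toFunctor : PreFrobenioid.IsOfIsotropicType (data G).toFunctor :=
  fun A => (PreFrobenioidData.ofFunctor_isIsotropic (data G).toFunctor A).mp (isOfIsotropicType.obj A)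

/-- `C` is of unit-trivial type, functor form (abc-iut-w5-d042's `Ex310.isOfUnitTrivialType`).
[cite: MochizukiFrdI2008, Rem. 4.12.1 p.95] -/
theorem isOfUnitTrivialType_toFunctor : PreFrobenioid.IsOfUnitTrivialType (data G).toFunctor :=
  fun A => (PreFrobenioidData.ofFunctor_isUnitTrivial (data G).toFunctor A).mp ((isOfUnitTrivialType G).obj A)

/-- **`1 ∈ Φ^birat(⋆)`**: the generator of `Φ^gp(⋆) = ℤ` lies in THE rational function monoid `Φ^birat` of
Prop. 4.4 (iii) — it is the birational germ of the pair (co-angular pre-step `(1, (1, 1))`, identity) at any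
object (so `Φ^birat = Φ^gp`). [cite: MochizukiFrdI2008, Prop. 4.4 (iii) p.83] -/
theorem of_one_mem_biratSubfunctor (A : C G) :
    Algebra.GrothendieckGroup.of (Multiplicative.ofAdd (1 : ℕ)) ∈
      (PreFrobenioid.biratSubfunctor (data G).toFunctor).carrier
        (PreFrobenioid.baseObj (data G).toFunctor A) := by
  let δ₁ : A ⟶ A := show G × StandardFrobenioid from (1, ⟨Multiplicative.ofAdd 1, 1⟩)
  have h₁ : PreFrobenioid.IsCoAngularPreStep (data G).toFunctor δ₁ :=
    ⟨(PreFrobenioidData.ofFunctor_isCoAngular (data G).toFunctor δ₁).mp (isCoAngular δ₁), rfl,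
      IsIso.of_groupoid _⟩
  have h₂ : PreFrobenioid.IsPreStep (data G).toFunctor (𝟙 A) := ⟨(data G).degFr_id A, IsIso.of_groupoid _⟩
  have hb : PreFrobenioid.BaseEquivalent (data G).toFunctor δ₁ (𝟙 A) := rfl
  have key := PreFrobenioid.div_invDiv_mem_biratSubfunctor (data G).toFunctor δ₁ (𝟙 A) h₁ h₂ hb
  have e₁ : PreFrobenioid.invDiv (data G).toFunctor δ₁ h₁.2.2 = Multiplicative.ofAdd (1 : ℕ) := rfl
  have e₂ : PreFrobenioid.invDiv (data G).toFunctor (𝟙 A) h₂.2 = 1 := (data G).div_id A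
  rw [e₁, e₂, MonoidHom.map_one, div_one] at key
  exact key

/-- In `ℤ_{≥0}` every primary element `a₀ = k ≥ 1` satisfies `a₀ ≼ 1` (`k ∣ k · 1`): the unique prime
of `ℤ_{≥0}` lies in the support of `1`. [cite: MochizukiFrdI2008, §0 p.12] -/
theorem precsim_ofAdd_one {a₀ : Multiplicative ℕ} (ha₀ : IsPrimary a₀) :
    Precsim a₀ (Multiplicative.ofAdd (1 : ℕ)) := by
  have hk : 0 < Multiplicative.toAdd a₀ :=
    Nat.pos_of_ne_zero fun h => ha₀.1 (by simpa using congrArg Multiplicative.ofAdd h)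
  refine ⟨Multiplicative.toAdd a₀, hk, ?_⟩
  rw [← ofAdd_nsmul, smul_eq_mul, mul_one, ofAdd_toAdd]

/-- **Every object of `C` is strictly rational** ([FrdI] Def. 4.5 (ii)) w.r.t. THE birationalization and the
canonical support `PrimarySupp`: for the (unique) prime `𝔭` of `Φ(⋆) = ℤ_{≥0}` the pair `(a, b) := (1, 0)`
works — `1 − 0 ∈ Φ^birat(⋆)`, `𝔭 ∈ Supp(1)`, `𝔭 ∉ Supp(0)` (`ℤ_{≥0}` is sharp).
[cite: MochizukiFrdI2008, Def. 4.5 (ii) p.86] -/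
theorem isStrictlyRational_rsParams (A : C G) :
    PreFrobenioidData.IsStrictlyRational
      (PreFrobenioid.rsParams (isFrobenioid G) fun a 𝔭 => PrimarySupp a 𝔭).B (fun a 𝔭 => PrimarySupp a 𝔭) A := by
  intro 𝔭
  obtain ⟨⟨a₀, ha₀⟩, rfl⟩ := Quotient.exists_rep 𝔭
  refine ⟨Multiplicative.ofAdd (1 : ℕ), 1, ?_, ⟨a₀, ha₀, rfl, ?_⟩, ?_⟩
  · rw [MonoidHom.map_one, div_one]
    exact of_one_mem_biratSubfunctor G A
  · exact precsim_ofAdd_one ha₀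
  · rintro ⟨a₁, ha₁, -, n, -, hdvd⟩
    rw [one_pow] at hdvd
    exact ha₁.1 (isSharp_multiplicative_nat.1 a₁ (isUnit_of_dvd_one hdvd))

/-- **Every object of `C` is rational** ([FrdI] Def. 4.5 (ii); pull-back morphism `= id`).
[cite: MochizukiFrdI2008, Def. 4.5 (ii) p.86] -/
theorem isRational_rsParams (A : C G) :
    PreFrobenioidData.IsRational
      (PreFrobenioid.rsParams (isFrobenioid G) fun a 𝔭 => PrimarySupp a 𝔭).B (fun a 𝔭 => PrimarySupp a 𝔭) A :=
  ⟨A, 𝟙 A, PreFrobenioidData.isPullbackMorphism_id _ A, isStrictlyRational_rsParams G A⟩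

/-- **Def. 4.5 (iii)(b) for `C`**: the image in `(C^un-tr)^birat` of the (unique, isotropic) object of `C^un-tr`
is Frobenius-compact — abc-iut-L6-t10's criterion at the divisor `d₀ = 1 ∈ ℤ_{≥0} = Φ(⋆)` (in `Φ^birat(⋆)`,
non-torsion in `ℤ`, and invariant under every base map since the transition maps of `Φ` are identities).
[cite: MochizukiFrdI2008, Def. 4.5 (iii) p.86] -/
theorem exists_isFrobeniusCompact_untrBirat :
    ∃ Y : (PreFrobenioid.rsParams (isFrobenioid G) fun a 𝔭 => PrimarySupp a 𝔭).BU.Birat,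
      (PreFrobenioid.rsParams (isFrobenioid G) fun a 𝔭 => PrimarySupp a 𝔭).BU.ops.IsFrobeniusCompact Y := by
  have hiso : (PreFrobenioidData.ofFunctor (data G).monFunctor (data G).toFunctor).IsIsotropic
      (SingleObj.star (G × StandardFrobenioid)) :=
    isOfIsotropicType.obj _
  let A : (PreFrobenioidData.ofFunctor (data G).monFunctor (data G).toFunctor).Untr :=
    { as := ⟨SingleObj.star (G × StandardFrobenioid), hiso⟩ }
  refine PreFrobenioid.Birat.exists_isFrobeniusCompact_untrBirat_of_invariant (isFrobenioid G) A
    (Algebra.GrothendieckGroup.of (Multiplicative.ofAdd (1 : ℕ))) ?_ ?_ ?_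
  · exact of_one_mem_biratSubfunctor G (SingleObj.star (G × StandardFrobenioid))
  · -- non-torsion: `N · 1 ≠ 0` in `ℤ_{≥0}`
    intro N hN h
    have h' : (Multiplicative.ofAdd (1 : ℕ)) ^ N = 1 :=
      Algebra.GrothendieckGroup.of_injective (M := Multiplicative ℕ) (by rw [map_pow, MonoidHom.map_one]; exact h)
    have h'' := congrArg Multiplicative.toAdd h'
    rw [toAdd_pow, toAdd_ofAdd, toAdd_one, smul_eq_mul, mul_one] at h''
    omega
  · -- invariance: the transition maps of `Φ` are identities
    intro f
    rw [pullGp_of]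
    rfl

/-- **Remark 4.12.1, conjunct (1): the Frobenioid `C` of Example 3.10 is of rationally standard type AT THE
parameters of Def. 4.5 (iii)** — THE birationalization `C → C^birat` (Prop. 4.4), THE unit-trivialisation
`C^un-tr` and ITS birationalization, and the canonical support `PrimarySupp` (`PreFrobenioid.rsParams`), for
EVERY group `G`: (a) birationally Frobenius-normalized by Thm. 5.1 (iv) (`C` is of isotropic and unit-trivial
type), rational, standard; (b) `(C^un-tr)^birat` admits a Frobenius-compact object.
[cite: MochizukiFrdI2008, Rem. 4.12.1 p.95] -/
theorem isOfRationallyStandardType_rsParams :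
    PreFrobenioidData.IsOfRationallyStandardType (data G)
      (PreFrobenioid.rsParams (isFrobenioid G) fun a 𝔭 => PrimarySupp a 𝔭) where
  biratFrobNormalized :=
    PreFrobenioid.isOfBiratFrobeniusNormalizedType_biratData_of_isOfUnitTrivialType (isFrobenioid G) _
      (isOfIsotropicType_toFunctor G) (isOfUnitTrivialType_toFunctor G)
  rational := isRational_rsParams G
  standard := isOfStandardType G
  frobCompact := exists_isFrobeniusCompact_untrBirat G

end Ex310

/-! ### Remark 4.12.1 at THE parameters -/

namespace Rmk4121

/-- **[FrdI] Remark 4.12.1 AT THE Def. 4.5 (iii) PARAMETERS** (FACT row F-1023 `Rmk4121.Statement` at its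
faithful instance): for every non-trivial group `G`, the Frobenioid `C = B(G × 𝔽) → D = B(G)` of Example 3.10
satisfies the named statement over `R :=` THE birationalization / unit-trivialisation bundle
`PreFrobenioid.rsParams Ex310.isFrobenioid PrimarySupp`: if `G` is residually finite, `C` is of rationally
standard type, of unit-trivial type, not of group-like type, `D` is Frobenius-slim and `D` is not Div-slim
(conjuncts (2)–(5) by abc-iut-w5-d042's `statement_of_isOfRationallyStandardType`; `G ≠ 1` is print's tacit
hypothesis, cf. `not_statement_punit`). [cite: MochizukiFrdI2008, Rem. 4.12.1 p.95] -/
theorem statement_rsParams (G : Type) [Group G] [Nontrivial G] :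
    Statement G (PreFrobenioid.rsParams (Ex310.isFrobenioid G) fun a 𝔭 => PrimarySupp a 𝔭) :=
  statement_of_isOfRationallyStandardType G _ fun _ => Ex310.isOfRationallyStandardType_rsParams G

end Rmk4121

end Literature.AlgebraicGeometry.Frobenioids
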